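import Summits.Ventures.QEC.Census.LPCertificate
import HarnessLib

/-!
# LP-infeasibility certificates for CRSS's linear program: the SPARSE check (same certificates, zero multipliers skipped)

Venture QEC (cell `qec`), item 119 «06.QHB7», rung X1. `LPCertificate.lean`'s `CRSSCert.check` evaluates, for every
`r ≤ n`, the full sums `Σ_{j ≤ n} y_j · (P_j(r,n) − [j = r]·2^{n−k})` and `Σ_{j ≤ n} s_j · (…) · P_j(r,n)` — `(n+1)²`
quaternary Krawtchouk values [CalderbankEtAl1998, §7 before Thm. 21] per branch, each a `Finset` sum with binomials; at
the boundary cells of the quantum Hamming bound for `d = 7` (`31 ≤ n ≤ 79`) this is the whole kernel cost (measured ≈ 66 s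
per cell at `n ≈ 52`), while the certificates themselves have only a handful of nonzero multipliers. `CRSSCert.checkS`
below is `check` with the two sums restricted to the indices of NONZERO multipliers (`Finset.filter`); since the omitted
summands are `0 · (…) = 0`, `kappaS = kappa` (`kappaS_eq`), `checkS = true → check = true` (`check_of_checkS`, a logical
implication), and soundness is `not_crssLPFeasible_of_check` verbatim: `not_crssLPFeasible_of_checkS`. HONEST FRAMING: a
re-implementation of a pure function with an equality proof; LP infeasibility certifies NON-existence only, never a distance.
[cite: CalderbankEtAl1998, §7 Thm. 21 (printed p. 26)]; [cite: MacWilliamsSloane1977, Ch. 17 §4 Thm. 20].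
-/

namespace Summit.Ventures.QEC.Census

open Finset Literature.InformationTheory.QuantumCodes

namespace CRSSCert

/-- The coefficient `κ_r` of `A_r` in the combined functional, summed over the NONZERO multipliers only. Column: definition (ours).
[cite: MacWilliamsSloane1977, Ch. 17 §4 Thm. 20] -/
def kappaS (c : CRSSCert) (n k : ℕ) (b : Bool) (r : ℕ) : ℚ :=
  (if r = 0 then c.u0 else 0) + (if r = 1 then c.u1 else 0) + c.mu + c.w * parityCoeff b r +
    ∑ j ∈ (range (n + 1)).filter (fun j => c.yAt j ≠ 0),
      c.yAt j * ((krawtchouk4 n j r : ℚ) - if j = r then 2 ^ (n - k) else 0) +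
    ∑ j ∈ (range (n + 1)).filter (fun j => c.sAt j ≠ 0),
      c.sAt j * (((if Even r then 2 else 0) - 1) * (krawtchouk4 n j r : ℚ))

/-- The sparse coefficient equals the full one (omitted summands are `0 · (…)`). Column: proved (ours). [folklore] -/
theorem kappaS_eq (c : CRSSCert) (n k : ℕ) (b : Bool) (r : ℕ) : c.kappaS n k b r = c.kappa n k b r := by
  unfold kappaS kappa
  rw [Finset.sum_filter, Finset.sum_filter]
  congr 1
  · congr 1
    refine Finset.sum_congr rfl fun j _ => ?_
    by_cases h : c.yAt j ≠ 0
    · rw [if_pos h]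
    · rw [if_neg h, not_not.1 h, zero_mul]
  · refine Finset.sum_congr rfl fun j _ => ?_
    by_cases h : c.sAt j ≠ 0
    · rw [if_pos h]
    · rw [if_neg h, not_not.1 h, zero_mul]

/-- **The sparse certificate checker** (pure, `decide`-able): literally `check` with `kappaS`. Column: definition (ours).
[cite: MacWilliamsSloane1977, Ch. 17 §4 Thm. 20] -/
def checkS (c : CRSSCert) (n k d : ℕ) (b : Bool) : Bool :=
  ((List.range (n + 1)).all fun j => !(decide (d ≤ j)) || decide (0 ≤ c.yAt j)) &&
  ((List.range (n + 1)).all fun j => decide (0 ≤ c.sAt j)) &&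
  ((List.range (n + 1)).all fun r => decide (c.kappaS n k b r ≤ 0)) &&
  decide (c.kappaConst n k < 0)

/-- A certificate that passes the sparse check passes the full check (logical implication; `check` is never evaluated).
Column: proved (ours). [cite: MacWilliamsSloane1977, Ch. 17 §4 Thm. 20] -/
theorem check_of_checkS {c : CRSSCert} {n k d : ℕ} {b : Bool} (h : c.checkS n k d b = true) : c.check n k d b = true := by
  unfold checkS at h
  unfold check
  simp only [kappaS_eq] at h
  exact h

end CRSSCert

/-- **Two certificates checked sparsely (one per parity branch) refute CRSS's system** — UNCONDITIONAL, soundness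
transferred from `not_crssLPFeasible_of_check`. Column: proved (ours).
[cite: CalderbankEtAl1998, §7 (after Thm. 22: «if … no feasible solution exists … no [[n,k,d]] code exists»)] -/
theorem not_crssLPFeasible_of_checkS {n k d : ℕ} (c₁ c₂ : CRSSCert) (h₁ : c₁.checkS n k d true = true)
    (h₂ : c₂.checkS n k d false = true) : ¬ CRSSLPFeasible n k d :=
  not_crssLPFeasible_of_check c₁ c₂ (CRSSCert.check_of_checkS h₁) (CRSSCert.check_of_checkS h₂)

end Summit.Ventures.QEC.Census
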